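import Summits.BirchSwinnertonDyer.Rank1Residual.Additive.RamifiedSevenGenusKatoExpReading
import HarnessLib

set_option autoImplicit false

/-!
# `𝒞₇` genus road (crux `EllipticUnitValueSevenOfGZK`, K7r), row K2C-9 (C6a): THE VALUES OF THE `exp*`-READING `valOf`
# — (eV) Kato's (15.9.1) on the elliptic-unit classes PROVED from the frame's Prop-15.9 pin, and (e2) CM-functoriality
# REDUCED to Kato's 15.14 «`O_K` acts through `K`» on the abstract datum `Φ.𝔏` (part 2 of 2)

Cell bsd-cm, seat bsd-cm-prr-ty1 g35 (literature-prover), row K2C-9 (C6a) (pen D1009 (6), D1019 (A), D1023 (C); director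
(739)(2)); file (F-A2) of this seat's CHECK.  Part 1 (`RamifiedSevenGenusKatoExpReading`) defines the reading
`valOf Φ ι₇ χ = [U : U′]⁻¹ · Σ_{q ∈ Γ/U′} χ(q̃)·(ι₇ ⊗ ιC)(𝔏_{U′}(q̃ · res(IK.proj n(χ) ·)))` and proves (e1′), (e1).

## (eV) — the value law (15.9.1) for `euK 𝔟` (Kato Prop. 15.9; the frame's pin `euK_spec` = the body `CM.EllipticZetaBody`)

For an admissible twist `𝔟` the frame supplies witnesses `(w_U)_U`, `(y_U)_U` with (Z1) norm-compatibility over the ray-class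
layers, (Z3a) `Γ_K`-equivariance of `𝔏` on the TORSION layers, (Z4) `𝔏_{U}(w_U) = 1 ⊗ y_U` with `y_U` fixed by `U`, (Z5) the
Galois character sum `Σ_{σ ∈ Γ/U} χ(σ)ιC(σ y_U) = (N𝔟 − ψ(𝔟)χ(𝔟)⁻¹)·Ω⁻¹·L_{7f}(ψ̄, χ, 1)`, and `IK.proj n (euK 𝔟) = w_{U_n}`.
Reading at `U = U_{n(χ)} ⊇ U′ = U′_{n(χ)}`: `res^{U}_{U′}(w_U) = res(cor(w_{U′})) = Σ_{i ∈ U/U′} s_i · w_{U′}` (tree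
`resLe_coresLe_eq_sum_conjMap`), so each summand of the reading is `Σ_i ιC((q̃ s_i)·y_{U′})` ((Z3a)+(Z4)), the double sum is
`[U : U′]` copies of the character sum over `Γ/U′` (right translation by `s_i ∈ U`, `χ` trivial on `U`, `y_{U′}` fixed by
`U′`), and (Z5) at the ray-class layer `U′` evaluates it; the normalisation of `valOf` cancels `[U : U′]` (`valOf_euK`).

## (e2) — CM-functoriality, REDUCED not proved

`ExpStarCMShape Φ` :≡ on every torsion layer `U′`, `𝔏_{U′}(φ_* c) = (1 ⊗ √−7)·𝔏_{U′}(c)` for the CM endomorphism `φ`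
(Kato 15.14: `O_λ` acts on `H^q(T)` and on `D_dR` through the CM lattice; NOT a clause of the tree's Prop-15.9 body, hence a
HYPOTHESIS — the road-D definition row of a DEFINED `exp*`, cf. `Kato2004.expStarCoord_endo_eq_mul`; the orientation of
`sqrtNegSeven` is the constructor's choice, (o-fix) D1019 (A)).  Under it `valOf χ (piK x) = ιC(√−7)·valOf χ x`
(`valOf_piK_of_expStarCM`: `piK = φ_*`, which commutes with `res` and `conj`, tree p776319).

## Contents (all PROVED; one `Prop`-valued definition with body; no instance, no notation, no axiom, no sorry, no named fact)
§1 `tensorReading_𝔏_conjMap_of_body`, `sum_chi_mul_embedding_smul_eq_galoisCharSum`, ★ `valOf_euK` (eV).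
§2 `ExpStarCMShape`, `expStarCMShape_iff`, `readingSum_isogenyLayerMapK`, ★ `valOf_piK_of_expStarCM` (e2 from the 𝔏-form).

HONEST LABEL: kernel theorems about a term and one hypothesis predicate; (e2) is REDUCED to a hypothesis on the abstract datum
`Φ.𝔏`, not proved; (eZ) is not touched; no stub is closed; stmt-BirchSwinnertonDyer-19945 OPEN (4 sorries);
`X12.CMRamifiedSeven` NOT proved; no summit statement is proved by this seat; BSD is claimed for no curve.

References: K. Kato, Astérisque 295 (2004) Prop. 15.9 / (15.9.1) (pp. 258–259), §15.5–15.6 (pp. 253–254), §15.8 (15.8.1)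
(p. 257), 15.14 (p. 264), (15.16.1) (p. 265) [Kato2004Asterisque]; J. Neukirch, A. Schmidt, K. Wingberg (2008) I §5 (1.5.4),
(1.5.6)–(1.5.7) [NeukirchSchmidtWingberg2008]; J.-P. Serre, *Local Fields* VII §5 [SerreLocalFields1979]; S. Bloch, K. Kato
(1990) Def. 3.10, Ex. 3.11 [BlochKato1990]; tree part 1, (C6-R) p800949, (P1) p776025, (L) p776319, `EllipticZetaReciprocity`,
`ContinuousCorestrictionResNormal`.
-/

noncomputable section

open scoped NumberField TensorProduct
open Field IsDedekindDomain NumberField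
open Literature.NumberTheory.GaloisRepresentations
open Literature.NumberTheory.EllipticCurves
open Literature.NumberTheory.EllipticCurves.Rank1Residual
open Literature.NumberTheory.EllipticCurves.IwasawaAlgebra
open Literature.NumberTheory.EllipticCurves.Kato2004
open Literature.NumberTheory.ComplexMultiplication.EllipticUnits
open Summit.BirchSwinnertonDyer.Rank1Residual

namespace Summit.BirchSwinnertonDyer.Rank1Residual.Additive.GenusSeven

section Frame

variable {W : WeierstrassCurve ℚ} [W.IsElliptic] [W.IsGloballyMinimal] [Fact (Nat.Prime 7)]
  [ContinuousSMul ℤ_[7] (W.tateModule 7)] {K : ZpExtension ℚ 7} {hK : K.IsCyclotomic}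
  {γ : Field.absoluteGaloisGroup ℚ} {I : IwasawaH1Data W 7 K γ}
  {F : GenusFrame} {θu : ∀ n : ℕ, globalUnitsOf (F.layer n)} {d : GenusDatum F θu}

namespace PinnedKatoGenusFrame

variable (Φ : PinnedKatoGenusFrame W K hK I d)

/-! ## §1 (eV): Kato's (15.9.1) for the elliptic-unit classes `euK 𝔟` -/

/-- **The reading of the Prop-15.9 body witness**: if `𝔏_{U′}(w_{U′}) = 1 ⊗ y_{U′}` ((Z4)) and `𝔏` is `Γ_K`-equivariant on the
torsion layer `U′` ((Z3a)), then `(ι₇ ⊗ ιC)(𝔏_{U′}(g · w_{U′})) = ιC(g·y_{U′})` for every `g ∈ Γ_K`.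
[cite: Kato2004Asterisque, Prop. 15.9 (p. 258, "an element of S(ψ) ⊗_K K′") and §15.8 (15.8.1) (p. 257)] -/
theorem tensorReading_𝔏_conjMap_of_body (ι₇ : ℚ_[7] →+* ℂ) (n : ℕ)
    {w : ∀ U : Subgroup (absoluteGaloisGroup Φ.Kcm), H1 (CM.tateRepK (W.baseChange Φ.Kcm) 7) U}
    {y : Subgroup (absoluteGaloisGroup Φ.Kcm) → AlgebraicClosure Φ.Kcm}
    (hZ3a : ∀ (m : ℕ) (σ : absoluteGaloisGroup Φ.Kcm)
      (c : H1 (CM.tateRepK (W.baseChange Φ.Kcm) 7) (CM.torsionLayer (W.baseChange Φ.Kcm) (7 ^ m * (7 * F.d)))),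
      Φ.𝔏 (CM.torsionLayer (W.baseChange Φ.Kcm) (7 ^ m * (7 * F.d)))
          (conjMap (CM.tateRepK (W.baseChange Φ.Kcm) 7).toTopRep (CM.torsionLayer (W.baseChange Φ.Kcm) (7 ^ m * (7 * F.d)))
            σ 1 c) =
        TensorProduct.map (LinearMap.id : ℚ_[7] →ₗ[ℤ] ℚ_[7])
          (((MulSemiringAction.toRingHom _ (AlgebraicClosure Φ.Kcm) σ : AlgebraicClosure Φ.Kcm →+*
              AlgebraicClosure Φ.Kcm) : AlgebraicClosure Φ.Kcm →+ AlgebraicClosure Φ.Kcm).toIntLinearMap)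
          (Φ.𝔏 (CM.torsionLayer (W.baseChange Φ.Kcm) (7 ^ m * (7 * F.d))) c))
    (hZ4 : Φ.𝔏 (Φ.torsionLayerAt n) (w (Φ.torsionLayerAt n)) = (1 : ℚ_[7]) ⊗ₜ[ℤ] y (Φ.torsionLayerAt n))
    (g : absoluteGaloisGroup Φ.Kcm) :
    tensorReading ι₇ Φ.ιC (Φ.𝔏 (Φ.torsionLayerAt n)
      (conjMap (CM.tateRepK (W.baseChange Φ.Kcm) 7).toTopRep (Φ.torsionLayerAt n) g 1 (w (Φ.torsionLayerAt n)))) =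
      Φ.ιC (g • y (Φ.torsionLayerAt n)) := by
  rw [hZ3a (Φ.torsionExp n) g, hZ4, TensorProduct.map_tmul, LinearMap.id_apply, tensorReading_tmul, map_one, one_mul]
  rfl

/-- **The Galois character sum re-indexed inside a bigger layer**: for `s ∈ U_n`, `χ` trivial on `U_n` and `y′` fixed by `U′_n`,
`Σ_{q ∈ Γ/U′_n} χ(q̃)·ιC((q̃·s)·y′) = galoisCharSum U′_n χ ιC y′`. [cite: Kato2004Asterisque, (15.9.1) (p. 259)]
[cite: SerreLocalFields1979, VII §5] -/
theorem sum_chi_mul_embedding_smul_eq_galoisCharSum (χ : absoluteGaloisGroup Φ.Kcm →ₜ* ℂˣ) (n : ℕ)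
    (hχ : ∀ σ ∈ Φ.towerK.layerSubgroup n, χ σ = 1) [Fintype (absoluteGaloisGroup Φ.Kcm ⧸ Φ.torsionLayerAt n)]
    {y' : AlgebraicClosure Φ.Kcm} (hy' : ∀ σ ∈ Φ.torsionLayerAt n, σ • y' = y')
    {s : absoluteGaloisGroup Φ.Kcm} (hs : s ∈ Φ.towerK.layerSubgroup n) :
    ∑ q : absoluteGaloisGroup Φ.Kcm ⧸ Φ.torsionLayerAt n, ((χ q.out : ℂˣ) : ℂ) * Φ.ιC ((q.out * s) • y') =
      CM.galoisCharSum (Φ.torsionLayerAt n) χ Φ.ιC y' := by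
  set Fy : absoluteGaloisGroup Φ.Kcm → ℂ := fun h => ((χ h : ℂˣ) : ℂ) * Φ.ιC (h • y') with hFy
  have hFinv : ∀ (h : absoluteGaloisGroup Φ.Kcm), ∀ u ∈ Φ.torsionLayerAt n, Fy (h * u) = Fy h := by
    intro h u hu
    simp only [hFy]
    rw [map_mul, hχ u (Φ.torsionLayerAt_le n hu), mul_one, mul_smul, hy' u hu]
  rw [CM.galoisCharSum, finsum_eq_sum_of_fintype]
  calc ∑ q : absoluteGaloisGroup Φ.Kcm ⧸ Φ.torsionLayerAt n, ((χ q.out : ℂˣ) : ℂ) * Φ.ιC ((q.out * s) • y')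
      = ∑ q : absoluteGaloisGroup Φ.Kcm ⧸ Φ.torsionLayerAt n, Fy (q.out * s) := by
        refine Finset.sum_congr rfl fun q _ => ?_
        simp only [hFy]
        rw [map_mul, hχ s hs, mul_one]
    _ = ∑ q : absoluteGaloisGroup Φ.Kcm ⧸ Φ.torsionLayerAt n, Fy q.out :=
        sum_quotient_out_mul_right (Φ.torsionLayerAt n) Fy hFinv s

/-- ★ (eV) **KATO'S VALUE LAW (15.9.1) FOR THE ELLIPTIC-UNIT CLASSES**: for an admissible twist `𝔟`, a character `χ` trivial on
`U_n` and any entire continuation `Lf` of the `7·(7d)`-depleted series `L(ψ̄, χ, s)`,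
`valOf χ (euK 𝔟) = (N𝔟 − ψ(𝔟)·χ(𝔟)⁻¹)·Ω⁻¹·Lf(1)` — from the frame's pin `euK_spec` (the Prop-15.9 body of the classes):
(Z1) `w_{U} = cor(w_{U′})`, `res ∘ cor = Σ_{U/U′} conj` (tree `resLe_coresLe_eq_sum_conjMap`), (Z3a)+(Z4) read each conjugate as
`ιC(g·y_{U′})`, the double sum is `[U : U′]` copies of the Galois character sum over `Γ/U′` (`sum_chi_mul_embedding_smul_eq_galoisCharSum`),
and (Z5) at the ray-class layer `U′` evaluates it; the normalisation `[U : U′]⁻¹` of `valOf` cancels the multiplicity.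
[cite: Kato2004Asterisque, Prop. 15.9 and (15.9.1) (pp. 258–259), §15.5–15.6 (pp. 253–254)] [cite: NeukirchSchmidtWingberg2008, I §5 (1.5.6)–(1.5.7)] -/
theorem valOf_euK (ι₇ : ℚ_[7] →+* ℂ) (𝔟 : Ideal (𝓞 Φ.Kcm)) (h𝔟 : IsTwist 7 Φ.𝔣 𝔟) (n : ℕ)
    (χ : absoluteGaloisGroup Φ.Kcm →ₜ* ℂˣ) (hχ : ∀ σ ∈ Φ.towerK.layerSubgroup n, χ σ = 1)
    (Lf : ℂ → ℂ) (hLf : CM.IsDepletedHeckeL Φ.ψ χ (7 * (7 * F.d)) Lf) :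
    Φ.valOf ι₇ χ (Φ.euK 𝔟) =
      (((Ideal.absNorm 𝔟 : ℕ) : ℂ) - CM.heckeCharIdealValue Φ.ψ 𝔟 * (heckeIdealValue χ 𝔟)⁻¹) * Φ.Ω⁻¹ * Lf 1 := by
  -- the level read and the layers
  have hlev := Φ.levelOf_spec χ hχ
  set m := Φ.levelOf χ with hm
  set T := (CM.tateRepK (W.baseChange Φ.Kcm) 7).toTopRep with hT
  have hU : CM.IsRayClassLayer (W.baseChange Φ.Kcm) 7 (7 * F.d) (Φ.towerK.layerSubgroup m) := Φ.isRayClassLayer_layer m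
  have hU' := Φ.isRayClassLayer_torsionLayerAt m
  have hle := Φ.torsionLayerAt_le m
  have hχ' : ∀ σ ∈ Φ.torsionLayerAt m, χ σ = 1 := fun σ hσ => hlev σ (hle hσ)
  haveI : Fintype (absoluteGaloisGroup Φ.Kcm ⧸ Φ.torsionLayerAt m) :=
    @Fintype.ofFinite _ (Φ.finite_quotient_torsionLayerAt m)
  haveI hfin : Fintype (Φ.towerK.layerSubgroup m ⧸ (Φ.torsionLayerAt m).subgroupOf (Φ.towerK.layerSubgroup m)) :=
    @Fintype.ofFinite _ (Φ.finite_layer_quotient_torsionLayerAt m)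
  -- the body of the classes of `euK 𝔟`
  obtain ⟨w, y, hbody, hproj, -⟩ := Φ.exists_body_of_isTwist h𝔟
  obtain ⟨hZ1, -, hZ3a, -, hZ4, hZ5⟩ := hbody
  have hcor : CM.layerCores (CM.tateRepK (W.baseChange Φ.Kcm) 7) hle hU'.isOpen (w (Φ.torsionLayerAt m)) =
      w (Φ.towerK.layerSubgroup m) := hZ1 _ _ hU' hU hle
  obtain ⟨hyfix, hyval⟩ := hZ4 _ hU'
  have hval := hZ5 _ hU' χ hχ' Lf hLf
  -- res ∘ cor = Σ conj
  have hrc : resLe T hle 1 (w (Φ.towerK.layerSubgroup m)) =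
      ∑ i : Φ.towerK.layerSubgroup m ⧸ (Φ.torsionLayerAt m).subgroupOf (Φ.towerK.layerSubgroup m),
        conjMap T (Φ.torsionLayerAt m) ((i.out : Φ.towerK.layerSubgroup m) : absoluteGaloisGroup Φ.Kcm) 1
          (w (Φ.torsionLayerAt m)) := by
    rw [← hcor]
    unfold CM.layerCores
    convert resLe_coresLe_eq_sum_conjMap T hle hU'.isOpen
      (s := fun i : Φ.towerK.layerSubgroup m ⧸ (Φ.torsionLayerAt m).subgroupOf (Φ.towerK.layerSubgroup m) => i.out)
      (fun i => QuotientGroup.out_eq' i) (w (Φ.torsionLayerAt m))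
  -- each summand of the reading
  have hsummand : ∀ q : absoluteGaloisGroup Φ.Kcm ⧸ Φ.torsionLayerAt m,
      tensorReading ι₇ Φ.ιC (Φ.𝔏 (Φ.torsionLayerAt m) (conjMap T (Φ.torsionLayerAt m) q.out 1
        (resLe T hle 1 (w (Φ.towerK.layerSubgroup m))))) =
      ∑ i : Φ.towerK.layerSubgroup m ⧸ (Φ.torsionLayerAt m).subgroupOf (Φ.towerK.layerSubgroup m),
        Φ.ιC ((q.out * ((i.out : Φ.towerK.layerSubgroup m) : absoluteGaloisGroup Φ.Kcm)) • y (Φ.torsionLayerAt m)) := by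
    intro q
    rw [hrc, map_sum, map_sum, map_sum]
    refine Finset.sum_congr rfl fun i _ => ?_
    rw [← conjMap_mul_apply_one]
    exact Φ.tensorReading_𝔏_conjMap_of_body ι₇ m hZ3a hyval _
  -- assemble: the un-normalised reading is `[U : U′]` copies of the value
  have hprojm : Φ.IK.proj m (Φ.euK 𝔟) = w (Φ.towerK.layerSubgroup m) := hproj m
  have hread : Φ.readingSum ι₇ χ m (w (Φ.towerK.layerSubgroup m)) =
      ((((Φ.torsionLayerAt m).subgroupOf (Φ.towerK.layerSubgroup m)).index : ℕ) : ℂ) *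
        ((((Ideal.absNorm 𝔟 : ℕ) : ℂ) - CM.heckeCharIdealValue Φ.ψ 𝔟 * (heckeIdealValue χ 𝔟)⁻¹) * Φ.Ω⁻¹ * Lf 1) := by
    rw [readingSum_eq_sum, Subgroup.index_eq_card, Nat.card_eq_fintype_card]
    calc ∑ q : absoluteGaloisGroup Φ.Kcm ⧸ Φ.torsionLayerAt m, ((χ q.out : ℂˣ) : ℂ) *
          tensorReading ι₇ Φ.ιC (Φ.𝔏 (Φ.torsionLayerAt m) (conjMap T (Φ.torsionLayerAt m) q.out 1
            (resLe T hle 1 (w (Φ.towerK.layerSubgroup m)))))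
        = ∑ q : absoluteGaloisGroup Φ.Kcm ⧸ Φ.torsionLayerAt m,
            ∑ i : Φ.towerK.layerSubgroup m ⧸ (Φ.torsionLayerAt m).subgroupOf (Φ.towerK.layerSubgroup m),
              ((χ q.out : ℂˣ) : ℂ) *
                Φ.ιC ((q.out * ((i.out : Φ.towerK.layerSubgroup m) : absoluteGaloisGroup Φ.Kcm)) • y (Φ.torsionLayerAt m)) := by
          refine Finset.sum_congr rfl fun q _ => ?_
          rw [hsummand q, Finset.mul_sum]
      _ = ∑ i : Φ.towerK.layerSubgroup m ⧸ (Φ.torsionLayerAt m).subgroupOf (Φ.towerK.layerSubgroup m),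
            ∑ q : absoluteGaloisGroup Φ.Kcm ⧸ Φ.torsionLayerAt m, ((χ q.out : ℂˣ) : ℂ) *
              Φ.ιC ((q.out * ((i.out : Φ.towerK.layerSubgroup m) : absoluteGaloisGroup Φ.Kcm)) • y (Φ.torsionLayerAt m)) :=
          Finset.sum_comm
      _ = ∑ _i : Φ.towerK.layerSubgroup m ⧸ (Φ.torsionLayerAt m).subgroupOf (Φ.towerK.layerSubgroup m),
            (((Ideal.absNorm 𝔟 : ℕ) : ℂ) - CM.heckeCharIdealValue Φ.ψ 𝔟 * (heckeIdealValue χ 𝔟)⁻¹) * Φ.Ω⁻¹ * Lf 1 := by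
          refine Finset.sum_congr rfl fun i _ => ?_
          rw [Φ.sum_chi_mul_embedding_smul_eq_galoisCharSum χ m hlev hyfix (SetLike.coe_mem _), hval]
      _ = ((Fintype.card (Φ.towerK.layerSubgroup m ⧸ (Φ.torsionLayerAt m).subgroupOf (Φ.towerK.layerSubgroup m)) : ℕ) : ℂ) *
            ((((Ideal.absNorm 𝔟 : ℕ) : ℂ) - CM.heckeCharIdealValue Φ.ψ 𝔟 * (heckeIdealValue χ 𝔟)⁻¹) * Φ.Ω⁻¹ * Lf 1) := by
          rw [Finset.sum_const, Finset.card_univ, nsmul_eq_mul]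
  rw [valOf_apply, hprojm, hread, ← mul_assoc, inv_mul_cancel₀ (Φ.index_torsionLayerAt_ne_zero m), one_mul]

/-! ## §2 (e2): CM-functoriality from the `𝔏`-form `ExpStarCMShape` -/

/-- **`ExpStarCMShape Φ` — Kato 15.14 «`O_K` acts on the cohomology and on `D_dR` through the CM lattice» for the ABSTRACT datum
`Φ.𝔏`**: on every torsion layer `U′` the push-forward `φ_*` of the CM endomorphism `φ = √−7` multiplies the `exp*`-value by
`1 ⊗ √−7 ∈ ℚ₇ ⊗ K̄`.  This is the `𝔏`-form of the field (e2) of `KatoExpDatum`; it is NOT a clause of the tree's Prop-15.9 body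
(`CM.EllipticZetaBody` has only (Z3a) equivariance and (Z3b) locality), hence a HYPOTHESIS here (the road-D definition row:
a DEFINED `exp*`, cf. `Kato2004.expStarCoord_endo_eq_mul`), with the orientation of `sqrtNegSeven` the constructor's choice
((o-fix), D1019 (A)).  A predicate; nothing asserted. [cite: Kato2004Asterisque, 15.14 (p. 264) and §15.3 (p. 252)]
[cite: BlochKato1990, Def. 3.10 and Ex. 3.11 (functoriality)] -/
def ExpStarCMShape : Prop :=
  ∀ (m : ℕ) (c : H1 (CM.tateRepK (W.baseChange Φ.Kcm) 7) (CM.torsionLayer (W.baseChange Φ.Kcm) (7 ^ m * (7 * F.d)))),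
    Φ.𝔏 (CM.torsionLayer (W.baseChange Φ.Kcm) (7 ^ m * (7 * F.d)))
        (isogenyLayerMapK 7 Φ.φ (CM.torsionLayer (W.baseChange Φ.Kcm) (7 ^ m * (7 * F.d))) c) =
      ((1 : ℚ_[7]) ⊗ₜ[ℤ] algebraMap Φ.Kcm (AlgebraicClosure Φ.Kcm) Φ.sqrtNegSeven) *
        Φ.𝔏 (CM.torsionLayer (W.baseChange Φ.Kcm) (7 ^ m * (7 * F.d))) c

/-- Unfolding `ExpStarCMShape`. [cite: Kato2004Asterisque, 15.14 (p. 264)] -/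
theorem expStarCMShape_iff : Φ.ExpStarCMShape ↔
    ∀ (m : ℕ) (c : H1 (CM.tateRepK (W.baseChange Φ.Kcm) 7) (CM.torsionLayer (W.baseChange Φ.Kcm) (7 ^ m * (7 * F.d)))),
      Φ.𝔏 (CM.torsionLayer (W.baseChange Φ.Kcm) (7 ^ m * (7 * F.d)))
          (isogenyLayerMapK 7 Φ.φ (CM.torsionLayer (W.baseChange Φ.Kcm) (7 ^ m * (7 * F.d))) c) =
        ((1 : ℚ_[7]) ⊗ₜ[ℤ] algebraMap Φ.Kcm (AlgebraicClosure Φ.Kcm) Φ.sqrtNegSeven) *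
          Φ.𝔏 (CM.torsionLayer (W.baseChange Φ.Kcm) (7 ^ m * (7 * F.d))) c :=
  Iff.rfl

/-- The reading of `φ_*` of a class under `ExpStarCMShape`: `readingSum χ n (φ_* c) = ιC(√−7)·readingSum χ n c` (`φ_*` commutes with
`res` and `conj`, tree `isogenyLayerMapK_resLe` / `_conjMap`; the reading is multiplicative). [cite: Kato2004Asterisque, 15.14 (p. 264)] -/
theorem readingSum_isogenyLayerMapK (h2 : Φ.ExpStarCMShape) (ι₇ : ℚ_[7] →+* ℂ) (χ : absoluteGaloisGroup Φ.Kcm →ₜ* ℂˣ) (n : ℕ)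
    (c : H1 (CM.tateRepK (W.baseChange Φ.Kcm) 7) (Φ.towerK.layerSubgroup n)) :
    Φ.readingSum ι₇ χ n (isogenyLayerMapK 7 Φ.φ (Φ.towerK.layerSubgroup n) c) =
      Φ.ιC (algebraMap Φ.Kcm (AlgebraicClosure Φ.Kcm) Φ.sqrtNegSeven) * Φ.readingSum ι₇ χ n c := by
  haveI : Fintype (absoluteGaloisGroup Φ.Kcm ⧸ Φ.torsionLayerAt n) :=
    @Fintype.ofFinite _ (Φ.finite_quotient_torsionLayerAt n)
  rw [readingSum_eq_sum, readingSum_eq_sum, Finset.mul_sum]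
  refine Finset.sum_congr rfl fun q _ => ?_
  rw [← isogenyLayerMapK_resLe, ← isogenyLayerMapK_conjMap, h2 (Φ.torsionExp n), map_mul, tensorReading_tmul, map_one,
    one_mul]
  ring

/-- ★ (e2) **CM-FUNCTORIALITY of the reading from `ExpStarCMShape`**: `valOf χ (piK x) = ιC(√−7)·valOf χ x` — the CM operator
`piK = (φ)_*` (`piK_eq_isogenyMap`, `proj_isogenyMap`) acts on the values by `√−7`.  CONDITIONAL on the `𝔏`-form hypothesis.
[cite: Kato2004Asterisque, 15.14 (p. 264) and (15.16.1) (p. 265)] -/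
theorem valOf_piK_of_expStarCM (h2 : Φ.ExpStarCMShape) (ι₇ : ℚ_[7] →+* ℂ) (χ : absoluteGaloisGroup Φ.Kcm →ₜ* ℂˣ)
    (x : Φ.IK.H) :
    Φ.valOf ι₇ χ (Φ.piK x) = Φ.ιC (algebraMap Φ.Kcm (AlgebraicClosure Φ.Kcm) Φ.sqrtNegSeven) * Φ.valOf ι₇ χ x := by
  rw [valOf_apply, valOf_apply, Φ.piK_eq_isogenyMap, Φ.IK.proj_isogenyMap, Φ.readingSum_isogenyLayerMapK h2]
  ring

end PinnedKatoGenusFrame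

end Frame

end Summit.BirchSwinnertonDyer.Rank1Residual.Additive.GenusSeven

end
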